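import Summits.BirchSwinnertonDyer.BirchSwinnertonDyer.Theorems.GenusKolyvaginAtTwoTorsionCellSELNegTwistZ
import HarnessLib

/-!
# SEL (iso-class Selmer pair law), C1-I′: a NORMALISED extra relaxed class `z`

Crux R″ `RankOneTwoTorsionResidualAtTwo` (stmt-27478), LINE 49 «full_vertex», SUPPORT stub SEL
`IsoClassSelmerPairLawAtTwo`, the `C₁` half (LEAD memo `Cruxes/…/Lines/torsion_cell_full_vertex_SEL_C1_road_g36.md`,
§2 (R4): «multiplying by torsion normalises the free bits»).  Setting of part C1-I.

**`exists_relaxed_normalized`** — there are `z_a, z_b ∈ ℚˣ` supported on `S ∪ {q₀}` such that the E-class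
`c_E(z_a, z_b)` satisfies `E`'s local condition at every prime of `S`, with `q₀`-parities `(1+ε, ε)`, residues
`qr_{q₀}(z_a) = qr_{q₀}(z_b) = 0`, and signs `z_a < 0 < z_b`: the odd relaxed class of `exists_relaxed_odd`, its type
pinned by `pinned_bits_of_relaxed_odd`, multiplied by the torsion class of `E` that kills the remaining bits.

Everything is proved; no LINE 49 statement is restated; BSD is not advanced by this file alone.

## References

* [KlagsbrunMazurRubin2013] Z. Klagsbrun, B. Mazur, K. Rubin, Ann. of Math. 178 (2013), Thm. 3.9.
* [SilvermanAEC2009] J. H. Silverman, *The Arithmetic of Elliptic Curves*, 2nd ed., Prop. X.1.4, Thm. X.4.2.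
-/

noncomputable section

open scoped Classical

namespace Summit.BirchSwinnertonDyer.BirchSwinnertonDyer.Theorems.GenusKolyvaginAtTwo.TorsionCellSEL

open WeierstrassCurve WeierstrassCurve.Affine WeierstrassCurve.Affine.Point
open Literature.NumberTheory.GaloisRepresentations Literature.NumberTheory.EllipticCurves Field
open Literature.NumberTheory.EllipticCurves.TwoDescentLocal
open Literature.NumberTheory.EllipticCurves.KramerTwoDescent
open Literature.NumberTheory.QuadraticForms
open Summit.BirchSwinnertonDyer.BirchSwinnertonDyer.Theorems.GenusKolyvaginAtTwo.TorsionCellD0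
open IsDedekindDomain NumberField Rat.HeightOneSpectrum

variable (E : WeierstrassCurve ℚ) [E.IsElliptic] {e₁ e₂ e₃ : ℚ} (S : Finset ℕ) {q₀ : ℕ} [hq₀ : Fact q₀.Prime]

/-- `𝔽₂` arithmetic: `1 + ε + x = 1 ⟹ x = ε`. [folklore] -/
private theorem zmod2_solve₁'' (ε x : ZMod 2) (h : 1 + ε + x = 1) : x = ε := by revert ε x; decide

/-- `𝔽₂` arithmetic: `ε + x = 1 ⟹ x = 1 + ε`. [folklore] -/
private theorem zmod2_solve₂'' (ε x : ZMod 2) (h : ε + x = 1) : x = 1 + ε := by revert ε x; decide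

/-- `𝔽₂` arithmetic: `1 + (1 + ε) = ε`. [folklore] -/
private theorem zmod2_solve₃'' (ε : ZMod 2) : 1 + (1 + ε) = ε := by revert ε; decide

/-- `𝔽₂`: the pinned relation solved for the sign of `b`. [folklore] -/
private theorem zmod2_rel (ε xa xb s : ZMod 2) (h : (1 + ε) * (xb + s) + ε * (xa + s) = 0) :
    s = (1 + ε) * xb + ε * xa := by
  revert ε xa xb s h; decide

/-- **A NORMALISED EXTRA RELAXED CLASS** (see the module docstring).
[cite: KlagsbrunMazurRubin2013, Thm. 3.9] [cite: SilvermanAEC2009, Prop. X.1.4, Thm. X.4.2] -/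
theorem exists_relaxed_normalized (h : E.toAffine.SplitTwoTorsion e₁ e₂ e₃) (h12 : e₁ < e₂) (h23 : e₂ < e₃)
    (hS : ∀ ℓ ∈ S, ℓ.Prime) (h2S : 2 ∈ S)
    (hgood : ∀ ℓ : ℕ, (hℓ : ℓ.Prime) → ℓ ∉ S → haveI : Fact ℓ.Prime := ⟨hℓ⟩;
      padicValRat ℓ (e₁ - e₂) = 0 ∧ padicValRat ℓ (e₁ - e₃) = 0 ∧ padicValRat ℓ (e₂ - e₃) = 0)
    (hN : ∀ ℓ : ℕ, ℓ.Prime → ℓ ∉ S → ¬ ℓ ∣ E.conductorNorm ℤ)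
    (hrank : E.mordellWeilRank = 0) (hsha : ∀ x ∈ E.sha, (2 : ℕ) • x = 0 → x = 0) (hq₀S : q₀ ∉ S) (hq₀4 : q₀ % 4 = 3)
    (hδ₁ : qrBit q₀ ((e₁ - e₂) * (e₁ - e₃)) = 1) (hδ₂ : qrBit q₀ ((e₂ - e₁) * (e₂ - e₃)) = 1)
    {ε : ZMod 2} (hε : qrBit q₀ (e₂ - e₁) = ε) :
    ∃ za zb : ℚˣ,
      (∀ v : HeightOneSpectrum (𝓞 ℚ), natGenerator v ∈ S → E.twoDescentClass h za zb ∈ selmerLocalKer E (v.adicCompletion ℚ) 2) ∧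
      (∀ ℓ : ℕ, (hℓ : ℓ.Prime) → ℓ ∉ S → ℓ ≠ q₀ → haveI : Fact ℓ.Prime := ⟨hℓ⟩;
        parityBit ℓ (za : ℚ) = 0 ∧ parityBit ℓ (zb : ℚ) = 0) ∧
      parityBit q₀ (za : ℚ) = 1 + ε ∧ parityBit q₀ (zb : ℚ) = ε ∧ qrBit q₀ (za : ℚ) = 0 ∧ qrBit q₀ (zb : ℚ) = 0 ∧
      signBit (za : ℚ) = 1 ∧ signBit (zb : ℚ) = 0 := by
  obtain ⟨a, b, hloc, hsupp, hodd⟩ := exists_relaxed_odd E S h h12 h23 hS h2S hgood hN hrank hsha hq₀S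
  obtain ⟨hpa, hpb, hsa, hrel⟩ := pinned_bits_of_relaxed_odd E S h h12 h23 h2S hgood hq₀S hq₀4 hδ₁ hδ₂ hε a b hloc hsupp hodd
  have he12 : e₁ - e₂ ≠ 0 := sub_ne_zero.mpr h.ne₁₂
  have he21 : e₂ - e₁ ≠ 0 := sub_ne_zero.mpr h.ne₁₂.symm
  have he13 : e₁ - e₃ ≠ 0 := sub_ne_zero.mpr h.ne₁₃
  have he31 : e₃ - e₁ ≠ 0 := sub_ne_zero.mpr h.ne₁₃.symm
  have he23 : e₂ - e₃ ≠ 0 := sub_ne_zero.mpr h.ne₂₃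
  have he32 : e₃ - e₂ ≠ 0 := sub_ne_zero.mpr h.ne₂₃.symm
  -- bits of the torsion values at `q₀` and `∞`, parities off `S`
  have hm1 : qrBit q₀ (-1 : ℚ) = 1 := qrBit_neg_one_eq_one_of_emod_four hq₀4
  have hq12 : qrBit q₀ (e₁ - e₂) = 1 + ε := by rw [← neg_sub, qrBit_neg (p := q₀) he21, hm1, hε]
  have hq31 : qrBit q₀ (e₃ - e₁) = 1 + ε := by
    have h1 : qrBit q₀ (e₁ - e₃) = ε := by
      have := hδ₁; rw [qrBit_mul q₀ he12 he13, hq12] at this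
      exact zmod2_solve₁'' ε _ this
    rw [← neg_sub, qrBit_neg (p := q₀) he13, hm1, h1]
  have hq32 : qrBit q₀ (e₃ - e₂) = ε := by
    have h1 : qrBit q₀ (e₂ - e₃) = 1 + ε := by
      have := hδ₂; rw [qrBit_mul q₀ he21 he23, hε] at this
      exact zmod2_solve₂'' ε _ this
    rw [← neg_sub, qrBit_neg (p := q₀) he23, hm1, h1, zmod2_solve₃'']
  have sD₁ : signBit ((e₁ - e₂) * (e₁ - e₃)) = 0 :=
    (signBit_eq_zero_iff (mul_ne_zero he12 he13)).mpr (mul_pos_of_neg_of_neg (sub_neg.mpr h12) (sub_neg.mpr (h12.trans h23)))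
  have sD₂ : signBit ((e₂ - e₁) * (e₂ - e₃)) = 1 := by
    unfold signBit; rw [if_pos (mul_neg_of_pos_of_neg (sub_pos.mpr h12) (sub_neg.mpr h23))]
  have s12 : signBit (e₁ - e₂) = 1 := by unfold signBit; rw [if_pos (sub_neg.mpr h12)]
  have s21 : signBit (e₂ - e₁) = 0 := (signBit_eq_zero_iff he21).mpr (sub_pos.mpr h12)
  have s31 : signBit (e₃ - e₁) = 0 := (signBit_eq_zero_iff he31).mpr (sub_pos.mpr (h12.trans h23))
  have s32 : signBit (e₃ - e₂) = 0 := (signBit_eq_zero_iff he32).mpr (sub_pos.mpr h23)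
  have hparT : ∀ (x : ℚ), (x = (e₁ - e₂) * (e₁ - e₃) ∨ x = e₁ - e₂ ∨ x = e₂ - e₁ ∨ x = (e₂ - e₁) * (e₂ - e₃) ∨
      x = e₃ - e₁ ∨ x = e₃ - e₂) → ∀ ℓ : ℕ, (hℓ : ℓ.Prime) → ℓ ∉ S → haveI : Fact ℓ.Prime := ⟨hℓ⟩; parityBit ℓ x = 0 := by
    intro x hx ℓ hℓ hℓS
    haveI : Fact ℓ.Prime := ⟨hℓ⟩
    obtain ⟨g12, g13, g23⟩ := hgood ℓ hℓ hℓS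
    have g21 : padicValRat ℓ (e₂ - e₁) = 0 := by rw [← neg_sub, padicValRat.neg, g12]
    have g31 : padicValRat ℓ (e₃ - e₁) = 0 := by rw [← neg_sub, padicValRat.neg, g13]
    have g32 : padicValRat ℓ (e₃ - e₂) = 0 := by rw [← neg_sub, padicValRat.neg, g23]
    rcases hx with rfl | rfl | rfl | rfl | rfl | rfl
    · rw [parityBit_mul he12 he13]; simp [parityBit, g12, g13]
    · simp [parityBit, g12]
    · simp [parityBit, g21]
    · rw [parityBit_mul he21 he23]; simp [parityBit, g21, g23]
    · simp [parityBit, g31]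
    · simp [parityBit, g32]
  -- generic step: multiply by a Selmer torsion pair `(t₁, t₂)` with known bits
  have step : ∀ (t₁ t₂ : ℚˣ), E.twoDescentClass h t₁ t₂ ∈ E.selmerGroup 2 →
      (∀ ℓ : ℕ, (hℓ : ℓ.Prime) → ℓ ∉ S → haveI : Fact ℓ.Prime := ⟨hℓ⟩;
        parityBit ℓ (t₁ : ℚ) = 0 ∧ parityBit ℓ (t₂ : ℚ) = 0) →
      qrBit q₀ (t₁ : ℚ) = qrBit q₀ (a : ℚ) → qrBit q₀ (t₂ : ℚ) = qrBit q₀ (b : ℚ) → signBit (t₁ : ℚ) = 0 →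
      signBit (t₂ : ℚ) = signBit (b : ℚ) →
      ∃ za zb : ℚˣ,
        (∀ v : HeightOneSpectrum (𝓞 ℚ), natGenerator v ∈ S →
          E.twoDescentClass h za zb ∈ selmerLocalKer E (v.adicCompletion ℚ) 2) ∧
        (∀ ℓ : ℕ, (hℓ : ℓ.Prime) → ℓ ∉ S → ℓ ≠ q₀ → haveI : Fact ℓ.Prime := ⟨hℓ⟩;
          parityBit ℓ (za : ℚ) = 0 ∧ parityBit ℓ (zb : ℚ) = 0) ∧
        parityBit q₀ (za : ℚ) = 1 + ε ∧ parityBit q₀ (zb : ℚ) = ε ∧ qrBit q₀ (za : ℚ) = 0 ∧ qrBit q₀ (zb : ℚ) = 0 ∧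
        signBit (za : ℚ) = 1 ∧ signBit (zb : ℚ) = 0 := by
    intro t₁ t₂ ht hpar hr₁ hr₂ hs₁ hs₂
    obtain ⟨q1, q2⟩ := hpar q₀ hq₀.out hq₀S
    refine ⟨a * t₁, b * t₂, fun v hvS => ?_, fun ℓ hℓ hℓS hℓq => ?_, ?_, ?_, ?_, ?_, ?_, ?_⟩
    · rw [twoDescentClass_mul]; exact add_mem (hloc v hvS) (((mem_selmerGroup_iff _ _ _).mp ht).1 v)
    · haveI : Fact ℓ.Prime := ⟨hℓ⟩
      obtain ⟨p1, p2⟩ := hsupp ℓ hℓ hℓS hℓq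
      obtain ⟨t1, t2⟩ := hpar ℓ hℓ hℓS
      rw [Units.val_mul, Units.val_mul, parityBit_mul a.ne_zero t₁.ne_zero, parityBit_mul b.ne_zero t₂.ne_zero, p1, p2,
        t1, t2, add_zero]
      exact ⟨rfl, rfl⟩
    · rw [Units.val_mul, parityBit_mul a.ne_zero t₁.ne_zero, hpa, q1, add_zero]
    · rw [Units.val_mul, parityBit_mul b.ne_zero t₂.ne_zero, hpb, q2, add_zero]
    · rw [Units.val_mul, qrBit_mul q₀ a.ne_zero t₁.ne_zero, hr₁, CharTwo.add_self_eq_zero]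
    · rw [Units.val_mul, qrBit_mul q₀ b.ne_zero t₂.ne_zero, hr₂, CharTwo.add_self_eq_zero]
    · rw [Units.val_mul, signBit_mul a.ne_zero t₁.ne_zero, hsa, hs₁, add_zero]
    · rw [Units.val_mul, signBit_mul b.ne_zero t₂.ne_zero, hs₂, CharTwo.add_self_eq_zero]
  -- the four torsion classes and their data
  have hO : E.twoDescentClass h 1 1 ∈ E.selmerGroup 2 := by
    rw [← E.eq_twoDescentClass_of_kummerEquiv_eq h 1 1 (c := 0)
      (by rw [_root_.map_zero, _root_.map_zero, QuotientGroup.mk_one, ofMul_one])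
      (by rw [_root_.map_zero, _root_.map_zero, QuotientGroup.mk_one, ofMul_one])]
    exact zero_mem _
  have hT₁ : E.twoDescentClass h (Units.mk0 _ (mul_ne_zero he12 he13)) (Units.mk0 _ he12) ∈ E.selmerGroup 2 :=
    twoDescentClass_mem_selmerGroup_T₁ E h _ _ rfl rfl
  have hT₂ : E.twoDescentClass h (Units.mk0 _ he21) (Units.mk0 _ (mul_ne_zero he21 he23)) ∈ E.selmerGroup 2 :=
    twoDescentClass_mem_selmerGroup_T₂ E h _ _ rfl rfl
  have hT₃ : E.twoDescentClass h (Units.mk0 _ he31) (Units.mk0 _ he32) ∈ E.selmerGroup 2 :=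
    twoDescentClass_mem_selmerGroup_T₃ E h _ _ rfl rfl
  -- the sign of `b` from the pinned relation
  have hsb : signBit (b : ℚ) = (1 + ε) * qrBit q₀ (b : ℚ) + ε * qrBit q₀ (a : ℚ) := zmod2_rel _ _ _ _ hrel
  have hpar1 : ∀ ℓ : ℕ, (hℓ : ℓ.Prime) → ℓ ∉ S → haveI : Fact ℓ.Prime := ⟨hℓ⟩;
      parityBit ℓ ((1 : ℚˣ) : ℚ) = 0 ∧ parityBit ℓ ((1 : ℚˣ) : ℚ) = 0 := fun ℓ hℓ hℓS => by simp [parityBit]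
  have hparT₁ : ∀ ℓ : ℕ, (hℓ : ℓ.Prime) → ℓ ∉ S → haveI : Fact ℓ.Prime := ⟨hℓ⟩;
      parityBit ℓ ((Units.mk0 _ (mul_ne_zero he12 he13) : ℚˣ) : ℚ) = 0 ∧ parityBit ℓ ((Units.mk0 _ he12 : ℚˣ) : ℚ) = 0 :=
    fun ℓ hℓ hℓS => ⟨hparT _ (Or.inl rfl) ℓ hℓ hℓS, hparT _ (Or.inr (Or.inl rfl)) ℓ hℓ hℓS⟩
  have hparT₂ : ∀ ℓ : ℕ, (hℓ : ℓ.Prime) → ℓ ∉ S → haveI : Fact ℓ.Prime := ⟨hℓ⟩;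
      parityBit ℓ ((Units.mk0 _ he21 : ℚˣ) : ℚ) = 0 ∧ parityBit ℓ ((Units.mk0 _ (mul_ne_zero he21 he23) : ℚˣ) : ℚ) = 0 :=
    fun ℓ hℓ hℓS => ⟨hparT _ (Or.inr (Or.inr (Or.inl rfl))) ℓ hℓ hℓS, hparT _ (Or.inr (Or.inr (Or.inr (Or.inl rfl)))) ℓ hℓ hℓS⟩
  have hparT₃ : ∀ ℓ : ℕ, (hℓ : ℓ.Prime) → ℓ ∉ S → haveI : Fact ℓ.Prime := ⟨hℓ⟩;
      parityBit ℓ ((Units.mk0 _ he31 : ℚˣ) : ℚ) = 0 ∧ parityBit ℓ ((Units.mk0 _ he32 : ℚˣ) : ℚ) = 0 :=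
    fun ℓ hℓ hℓS => ⟨hparT _ (Or.inr (Or.inr (Or.inr (Or.inr (Or.inl rfl))))) ℓ hℓ hℓS,
      hparT _ (Or.inr (Or.inr (Or.inr (Or.inr (Or.inr rfl))))) ℓ hℓ hℓS⟩
  have s1 : signBit ((1 : ℚˣ) : ℚ) = 0 := by rw [Units.val_one]; exact (signBit_eq_zero_iff one_ne_zero).mpr one_pos
  have q1 : qrBit q₀ ((1 : ℚˣ) : ℚ) = 0 := by rw [Units.val_one, qrBit_one]
  -- case analysis on `ε` and the free bits `(qr_{q₀}(a), qr_{q₀}(b))`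
  have hz2 : ∀ x : ZMod 2, x = 0 ∨ x = 1 := by decide
  rcases hz2 ε with e0 | e0 <;> subst e0 <;> rcases hz2 (qrBit q₀ (a : ℚ)) with ra | ra <;>
    rcases hz2 (qrBit q₀ (b : ℚ)) with rb | rb <;> rw [ra, rb] at hsb
  · -- `ε = 0`, `(0,0)`: `O`
    exact step 1 1 hO hpar1 (by rw [q1, ra]) (by rw [q1, rb]) s1 (by rw [s1, hsb]; decide)
  · -- `ε = 0`, `(0,1)`: `T₂`
    exact step _ _ hT₂ hparT₂ (by rw [Units.val_mk0, hε, ra]) (by rw [Units.val_mk0, hδ₂, rb]) (by rw [Units.val_mk0, s21])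
      (by rw [Units.val_mk0, sD₂, hsb]; decide)
  · -- `ε = 0`, `(1,0)`: `T₃`
    exact step _ _ hT₃ hparT₃ (by rw [Units.val_mk0, hq31, ra]; decide) (by rw [Units.val_mk0, hq32, rb])
      (by rw [Units.val_mk0, s31]) (by rw [Units.val_mk0, s32, hsb]; decide)
  · -- `ε = 0`, `(1,1)`: `T₁`
    exact step _ _ hT₁ hparT₁ (by rw [Units.val_mk0, hδ₁, ra]) (by rw [Units.val_mk0, hq12, rb]; decide)
      (by rw [Units.val_mk0, sD₁]) (by rw [Units.val_mk0, s12, hsb]; decide)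
  · -- `ε = 1`, `(0,0)`: `O`
    exact step 1 1 hO hpar1 (by rw [q1, ra]) (by rw [q1, rb]) s1 (by rw [s1, hsb]; decide)
  · -- `ε = 1`, `(0,1)`: `T₃`
    exact step _ _ hT₃ hparT₃ (by rw [Units.val_mk0, hq31, ra]; decide) (by rw [Units.val_mk0, hq32, rb])
      (by rw [Units.val_mk0, s31]) (by rw [Units.val_mk0, s32, hsb]; decide)
  · -- `ε = 1`, `(1,0)`: `T₁`
    exact step _ _ hT₁ hparT₁ (by rw [Units.val_mk0, hδ₁, ra]) (by rw [Units.val_mk0, hq12, rb]; decide)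
      (by rw [Units.val_mk0, sD₁]) (by rw [Units.val_mk0, s12, hsb]; decide)
  · -- `ε = 1`, `(1,1)`: `T₂`
    exact step _ _ hT₂ hparT₂ (by rw [Units.val_mk0, hε, ra]) (by rw [Units.val_mk0, hδ₂, rb]) (by rw [Units.val_mk0, s21])
      (by rw [Units.val_mk0, sD₂, hsb]; decide)

end Summit.BirchSwinnertonDyer.BirchSwinnertonDyer.Theorems.GenusKolyvaginAtTwo.TorsionCellSEL

end
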